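import Summits.QuantumFields.BalabanUV.T4Continuum.Support.NE7EnergyRateWGenericL
import Summits.QuantumFields.BalabanUV.T4Continuum.Support.NE7AllMinimisersSmallGeneric
import Summits.QuantumFields.BalabanUV.T4Continuum.Support.NE7EnergyRateWSU2End
import HarnessLib

/-!
# NE7EnergyRateWEndGenericL — PORT MAP P3.5 (END currency): gen 105's `NE7EnergyRateWSU2End.ne3EnergyRateWSup_SU2_smallData` AT `d = 4`, ANY BLOCK SIZE `L ≥ 2`, ANY `U(n)` —
# T-E_w♯ IN THE CURRENCY OF ROUTE 1's END (`Regular … ε g`, the small data): `∃ ε₀ > 0, ∀ 0 < ε ≤ ε₀, ∀ g > 0, ∃ C s ≥ 0, ∀ N ≥ 1, ∃ δ_V > 0, ∀ dom ⊆ {V | unitary, N-periodic,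
# SmallField V δ_V}, NE3EnergyRateWSup 4 (sfClass 4 L N ε) L N ε g C s dom`

Cell `pub-balaban`, rung (B)+1 sub-cell t4, lineage `b2b-balaban-t4-ne7b-p1` (row NE7b OWNER + CRUX PROVER), generation 156 — INTERFACE REQUEST NE7→NE7b PORT P3.5 (road
t4-ne7-p1 g109, [NE7P1-G109-INBOX-2]∕[-INBOX-3]; memo `t4/b2b-balaban-t4-ne7-p1-g109/ROAD-G109.md` §3), the END-currency wrapper of ✓ p810906 `ne3EnergyRateWSup_anyGroup_L`: `b = ε∕4`
over the small data by the road's ✓ p810303 `all_minimisers_small_generic`, `residualScale_mono_b`, the competitor line `ε∕4 + 226·320²·L²·(ε∕4)² ≤ ε` folded into `ε₀`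
(`ε ≤ 12∕(226·320²·L²)`; at `L = 2` gen 105 used `ε ≤ 10⁻⁸`).
WHAT ([folklore]; 0 def, 0 sorry).  **`ne3EnergyRateWSup_smallData_L`**.
HONEST FRAMING (page 1): composition of two landed kernel theorems under the road's recipe; nothing of Bałaban's asserted; constants existential; NOT NE3∕NE7 as spine nodes; row NE7b
(`T4WeightBudget.RelWeightBound`) NOT PRINTED ∕ NOT PROVED; spine count = dagwriter∕referees' call; finite 4-torus — NOT infinite volume, NOT mass gap, NOT BetaPertH, NOT Clay
(continuum YM on T⁴ ⇐ BetaPertH ∧ nine spine estimates).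
-/

set_option autoImplicit false

open scoped BigOperators Matrix Matrix.Norms.L2Operator
open NormedSpace Finset Set

namespace Summit.QuantumFields.BalabanUV.T4Continuum.NE7EnergyRateWEndGenericL

open Literature.MathematicalPhysics.QuantumFieldTheory.Balaban1983to89
open B7Prop1Explicit B7Prop2Explicit
open T4AveragingDeficitWall (IsUnitaryCfg SmallField)
open T4AveragingDeficitWallBoundary (IsPeriodicCfg)
open MinimalActionRate (sfClass Regular)
open NE3EnergyWeightedSupShape (NE3EnergyRateWSup)
open NE7EnergyRateWGenericL (ne3EnergyRateWSup_anyGroup_L)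
open NE7EnergyRateWSU2End (residualScale_mono_b)
open NE7AllMinimisersSmallGeneric (all_minimisers_small_generic)

noncomputable section

variable {n : Type} [Fintype n] [DecidableEq n]

/-- **T-E_w♯ IN THE END's CURRENCY AT BLOCK SIZE `L ≥ 2`, ANY `U(n)`** (statement in the file header). [folklore] -/
theorem ne3EnergyRateWSup_smallData_L [Nonempty n] {L : ℕ} (hL : 2 ≤ L) :
    ∃ ε₀ : ℝ, 0 < ε₀ ∧ ∀ ε : ℝ, 0 < ε → ε ≤ ε₀ → ∀ g : ℝ, 0 < g →
      ∃ C s : ℝ, 0 ≤ C ∧ 0 ≤ s ∧ ∀ (N : ℕ) [NeZero N], 1 ≤ N → ∃ δV : ℝ, 0 < δV ∧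
        ∀ dom : Set (Site 4 → Fin 4 → (Matrix n n ℂ)ˣ),
          dom ⊆ {V : Site 4 → Fin 4 → (Matrix n n ℂ)ˣ | IsUnitaryCfg V ∧ IsPeriodicCfg V (N : ℤ) ∧ SmallField V δV} →
          NE3EnergyRateWSup 4 (sfClass 4 L N ε) L N ε g C s dom := by
  obtain ⟨ε₁, hε₁, H1⟩ := ne3EnergyRateWSup_anyGroup_L (n := n) hL
  obtain ⟨ε₂, hε₂, H2⟩ := all_minimisers_small_generic (n := n) hL
  have hL2 : (0 : ℝ) < 226 * 320 ^ 2 * (L : ℝ) ^ 2 := by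
    have : (0 : ℝ) < (L : ℝ) := by exact_mod_cast (show 0 < L by omega)
    positivity
  refine ⟨min ε₁ (min ε₂ (12 / (226 * 320 ^ 2 * (L : ℝ) ^ 2))), lt_min hε₁ (lt_min hε₂ (by positivity)), ?_⟩
  intro ε hε hεle g hg
  have hεε₁ : ε ≤ ε₁ := hεle.trans (min_le_left _ _)
  have hεε₂ : ε ≤ ε₂ := hεle.trans ((min_le_right _ _).trans (min_le_left _ _))
  have hε12 : ε ≤ 12 / (226 * 320 ^ 2 * (L : ℝ) ^ 2) := hεle.trans ((min_le_right _ _).trans (min_le_right _ _))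
  -- T-E_w♯ at `b = ε/4`: the line `ε/4 + c(L)(ε/4)² ≤ ε` from `c(L)·ε ≤ 12`
  have hb : (0 : ℝ) ≤ ε / 4 := by positivity
  have hcε : 226 * 320 ^ 2 * (L : ℝ) ^ 2 * ε ≤ 12 := by
    rw [le_div_iff₀ hL2] at hε12; linarith
  have hbq : ε / 4 + 226 * 320 ^ 2 * (L : ℝ) ^ 2 * (ε / 4) ^ 2 ≤ ε := by
    have e : 226 * 320 ^ 2 * (L : ℝ) ^ 2 * (ε / 4) ^ 2 = (226 * 320 ^ 2 * (L : ℝ) ^ 2 * ε) * ε / 16 := by ring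
    rw [e]
    nlinarith
  obtain ⟨C, s, hC, hs, HC⟩ := H1 ε hε hεε₁ (ε / 4) g hb hbq hg
  refine ⟨C, s, hC, hs, fun N _ hN => ?_⟩
  obtain ⟨δV, hδV, Hsmall⟩ := H2 ε hε hεε₂ N hN
  refine ⟨δV, hδV, fun dom hdom => ?_⟩
  intro k hk V hV UA UB hA hB hreg
  -- every minimiser of the `ε`-class is `SmallField ((ε/4)/M²)`: `U_B` is `Regular (ε/4) g`
  have hsmallB := Hsmall V (hdom hV) (k + 1) UB hB
  have hreg' : Regular 4 L N (ε / 4) g (k + 1) UB := ⟨hreg.unitary, hreg.periodic, hsmallB, hreg.grad⟩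
  obtain ⟨u, Z, hu, huP, hZs, hZP, hgauge, hE, hsup⟩ := HC N dom k hk V hV UA UB hA hB hreg'
  refine ⟨u, Z, hu, huP, hZs, hZP, hgauge, hE.trans (mul_le_mul_of_nonneg_left ?_ hC), hsup⟩
  exact residualScale_mono_b 4 L N k hb (by linarith)

end

end Summit.QuantumFields.BalabanUV.T4Continuum.NE7EnergyRateWEndGenericL
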